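import Mathlib
import Literature.MathematicalPhysics.QuantumLattice.WilsonDiracAP
import Summits.QuantumFields.QCD.Theorems.WilsonQuarkChessboardFlatCellOptimalStubFreeBlochBlocksAllN
import Summits.QuantumFields.QCD.Theorems.QuarksAsStableActionCriticalLineDiamagnetismStubBlockHessianFormulaAux

/-!
# The free block propagator in the plane-wave basis, `N` colours: trace formulas
(helper for crux stmt-QuantumFields-9307 `FlatCellOptimal`, line `registered`, stub
`stub_hessianMarginAllN`, sub-goal `stub_blockHessianFormulaAuxAllN` — the `Fin 3 ↦ Fin N` port of the
sibling crux stmt-QuantumFields-9734's `…CriticalLineDiamagnetismStubBlockHessianFormulaAux`, gap G2a,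
wave 5)

What.  On the `2⁴` block `(ℤ/2)⁴` (colour `Fin N`, ANY `N : ℕ`, spin `Fin 4`) with constant central link
phases `u_μ = e^{iθ_μ}·1 ∈ U(N)`, the free `r = 1` Wilson–Dirac operator
`B⁰ = wilsonDirac ρ_N (fun e => u e.2) m 1` is diagonalised by the 16 REAL plane waves
`χ_s(x) = (−1)^{s·x}`, `s ∈ (ℤ/2)⁴`: `B⁰⁻¹ = P · blockdiag (1_N ⊗ S(P_s)) · Pᴴ`, `P = F ⊗ 1_{N×4}`,
`F(x,s) = χ_s(x)/4`, with the free propagator `S(P) = (M_W(P)·1 − iΣ_κ sin P_κ γ_κ) / h(P)`,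
`M_W(P) = m + Σ_κ (1 − cos P_κ)`, `h(P) = M_W(P)² + Σ_κ sin² P_κ`, at the block momenta `P_s = θ + π s`
(when all `h(P_s) > 0`).  Consequently, for ALL matrices `A, B` on the block,
`tr (B⁰⁻¹ A) = (1/16) Σ_s tr ((1_N ⊗ S(P_s)) Â(s,s))` and
`tr (B⁰⁻¹ A B⁰⁻¹ B) = (1/256) Σ_{s,s'} tr ((1_N ⊗ S(P_s)) Â(s,s') (1_N ⊗ S(P_{s'})) B̂(s',s))`
with the momentum blocks `Â(s,s') = Σ_{y,z} χ_s(y) χ_{s'}(z) A[(y,·),(z,·)] ∈ M_{N×4}(ℂ)`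
(`BlockHessianFormula.trace_formulas`, `stub_blockHessianFormulaAuxAllN`; the sibling's
`stub_blockHessianFormulaAux` is the case `N = 3`).  The statement is the sibling's with `Fin 3 ↦ Fin N`
and with the `let`s `B0, Mw, h, S, mom, chi, hat` turned into universally quantified variables with
defining equations, so that the registered signature contains no `:=`; the formulas are `N`-free
(the colour factor is `1_N`).

How.  `B⁰ P = P · blockdiag (1_N ⊗ N(P_s))` is the colour-generic
`FreeBlochBlocks.wilsonDirac_dirTwist_mul_planeP` (`…FlatCellOptimalStubFreeBlochBlocksAllN`) at `L = 2`
(`N(P) = M_W·1 + iΣ sin γ`); Clifford `Nᴴ N = h·1` gives `S N = 1`, so `B⁰ (P Sd Pᴴ) = P Pᴴ = 1`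
(`Matrix.inv_eq_right_inv`, `planeP_conjTranspose_mul_self` of `…StubFreeTwistedFourierAuxAllN` for
any colour index); then `tr (P Sd Pᴴ A P Sd Pᴴ B) = tr (Sd (PᴴAP) Sd (PᴴBP))` and the colour-free block
bookkeeping of the sibling file (`trace_blockDiag_mul`, `trace_blockDiag_mul_mul`, `sandwich_apply`,
`kron_one_mul_blockDiag`, `blockDiag_mul_blockDiag`, `symbolInv_mul_symbol`, `torusChar_two`), which is
stated for arbitrary finite index types and re-EXPORTED here under the same names (aliases, no
restatement).

References: Montvay–Münster, *Quantum Fields on a Lattice* §4.2 (free Wilson fermions in momentum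
space); folklore linear algebra.  Pure theorem file (no `def`s).
-/

noncomputable section

open scoped BigOperators Classical Matrix ComplexConjugate
open Finset
open Literature.MathematicalPhysics.QuantumLattice Literature.MathematicalPhysics.QuantumFieldTheory
  Literature.Probability.LatticeModels

namespace Summit.QuantumFields.QCD.Cruxes.FlatCellOptimal.BlockHessian

open scoped Kronecker
open Complex (I)
open Summit.QuantumFields.QCD.Cruxes.FlatCellOptimal.FreeBlocks
open Summit.QuantumFields.QCD.Cruxes.FlatCellOptimal.FreeTwistedFourier (planeP_conjTranspose_mul_self)

namespace BlockHessianFormula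

/-! ### The colour-free lemmas of the sibling file, re-exported under the same names (aliases) -/

export Summit.QuantumFields.QCD.Cruxes.CriticalLineDiamagnetism.ChessboardCellGain.BlockHessianFormula
  (torusChar_two add_add_cancel_left exists_val_add trig_val_add trace_mul_of_antiHerm trace_mul_eq_sum
    blockDiag_mul_blockDiag blockDiag_mul_apply trace_blockDiag_mul trace_blockDiag_mul_mul
    kron_one_mul_blockDiag sandwich_apply symbol_conjTranspose symbolInv_mul_symbol)

/-! ### The free block operator in the plane-wave basis, `N` colours -/

section FreeBlock

variable {N : ℕ} (m : ℝ) (θ : Fin 4 → ℝ) (u : Fin 4 → Matrix.unitaryGroup (Fin N) ℂ)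
  (B0 : Matrix (TorusSite 4 2 × Fin N × Fin 4) (TorusSite 4 2 × Fin N × Fin 4) ℂ)
  (Mw h : (Fin 4 → ℝ) → ℝ) (S : (Fin 4 → ℝ) → Matrix (Fin 4) (Fin 4) ℂ)
  (mom : (Fin 4 → ZMod 2) → Fin 4 → ℝ) (chi : (Fin 4 → ZMod 2) → TorusSite 4 2 → ℝ)
  (hat : Matrix (TorusSite 4 2 × Fin N × Fin 4) (TorusSite 4 2 × Fin N × Fin 4) ℂ →
    (Fin 4 → ZMod 2) → (Fin 4 → ZMod 2) → Matrix (Fin N × Fin 4) (Fin N × Fin 4) ℂ)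

/-- **`B⁰⁻¹ = P · blockdiag (1_N ⊗ S(P_s)) · Pᴴ`** for the free block operator with constant central
direction phases and `N` colours, `P = F ⊗ 1` the unitary plane-wave matrix (all `h(P_s) > 0`). -/
theorem inv_eq
    (hu : ∀ μ, (u μ : Matrix (Fin N) (Fin N) ℂ) = Complex.exp (↑(θ μ) * I) • (1 : Matrix (Fin N) (Fin N) ℂ))
    (hB0 : B0 = wilsonDirac (unitaryFundamentalRep (Fin N) ℂ) (fun e : Edge 4 2 => u e.2) m 1)
    (hMw : ∀ P, Mw P = m + ∑ κ, (1 - Real.cos (P κ)))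
    (hh : ∀ P, h P = Mw P ^ 2 + ∑ κ, Real.sin (P κ) ^ 2)
    (hS : ∀ P, S P = ((h P)⁻¹ : ℂ) • (((Mw P : ℝ) : ℂ) • (1 : Matrix (Fin 4) (Fin 4) ℂ) -
      I • ∑ κ, ((Real.sin (P κ) : ℝ) : ℂ) • euclideanGamma κ))
    (hmom : ∀ s κ, mom s κ = θ κ + Real.pi * ((s κ).val : ℝ)) (hpos : ∀ s, 0 < h (mom s)) :
    B0⁻¹ = (Matrix.of fun x k : TorusSite 4 2 => (((2 : ℕ) : ℂ) ^ 2)⁻¹ * torusChar k x) ⊗ₖ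
        (1 : Matrix (Fin N × Fin 4) (Fin N × Fin 4) ℂ) *
      (Matrix.of fun q q' : TorusSite 4 2 × Fin N × Fin 4 =>
        if q.1 = q'.1 then ((1 : Matrix (Fin N) (Fin N) ℂ) ⊗ₖ S (mom q.1)) q.2 q'.2 else 0) *
      ((Matrix.of fun x k : TorusSite 4 2 => (((2 : ℕ) : ℂ) ^ 2)⁻¹ * torusChar k x) ⊗ₖ
        (1 : Matrix (Fin N × Fin 4) (Fin N × Fin 4) ℂ))ᴴ := by
  -- adapted from the sibling's `BlockHessianFormula.inv_eq` (`Fin 3 ↦ Fin N`)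
  -- the plane-wave diagonalisation `B⁰ P = P · blockdiag (1 ⊗ Ns)` at `L = 2`
  have hθ' : ∀ v t : ℝ, 2 * Real.pi * v / ((2 : ℕ) : ℝ) + t = t + Real.pi * v := fun v t => by
    push_cast; ring
  have hA := FreeBlochBlocks.wilsonDirac_dirTwist_mul_planeP (L := 2) θ m u hu
  simp only [hθ'] at hA
  set P : Matrix (TorusSite 4 2 × Fin N × Fin 4) (TorusSite 4 2 × Fin N × Fin 4) ℂ :=
    (Matrix.of fun x k : TorusSite 4 2 => (((2 : ℕ) : ℂ) ^ 2)⁻¹ * torusChar k x) ⊗ₖ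
      (1 : Matrix (Fin N × Fin 4) (Fin N × Fin 4) ℂ) with hP
  set Ns : TorusSite 4 2 → Matrix (Fin 4) (Fin 4) ℂ := fun k =>
    (((m + ∑ μ, (1 - Real.cos (θ μ + Real.pi * ((k μ).val : ℝ)))) : ℝ) : ℂ) •
        (1 : Matrix (Fin 4) (Fin 4) ℂ) +
      I • ∑ μ, ((Real.sin (θ μ + Real.pi * ((k μ).val : ℝ)) : ℝ) : ℂ) • euclideanGamma μ with hNs
  have hBP : B0 * P = P * Matrix.of fun q q' : TorusSite 4 2 × Fin N × Fin 4 =>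
      if q.1 = q'.1 then ((1 : Matrix (Fin N) (Fin N) ℂ) ⊗ₖ Ns q.1) q.2 q'.2 else 0 := by
    rw [hP, kron_one_mul_blockDiag _ (fun k => (1 : Matrix (Fin N) (Fin N) ℂ) ⊗ₖ Ns k), hB0]
    exact hA
  -- the Clifford inverse blockwise: `S(P_k) Ns(k) = 1`
  have hSN : ∀ k : TorusSite 4 2, S (mom k) * Ns k = 1 := by
    intro k
    have hk := hpos k
    rw [hh, hMw] at hk
    rw [hS, hh, hMw, hNs]
    simp only [hmom] at hk ⊢
    exact symbolInv_mul_symbol _ (fun μ => Real.sin (θ μ + Real.pi * ((k μ).val : ℝ))) hk.ne'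
  have hNS : (Matrix.of fun q q' : TorusSite 4 2 × Fin N × Fin 4 =>
      if q.1 = q'.1 then ((1 : Matrix (Fin N) (Fin N) ℂ) ⊗ₖ Ns q.1) q.2 q'.2 else 0) *
      (Matrix.of fun q q' : TorusSite 4 2 × Fin N × Fin 4 =>
        if q.1 = q'.1 then ((1 : Matrix (Fin N) (Fin N) ℂ) ⊗ₖ S (mom q.1)) q.2 q'.2 else 0) = 1 := by
    rw [blockDiag_mul_blockDiag (fun k => (1 : Matrix (Fin N) (Fin N) ℂ) ⊗ₖ Ns k)
      (fun k => (1 : Matrix (Fin N) (Fin N) ℂ) ⊗ₖ S (mom k))]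
    ext ⟨k, c⟩ ⟨k', c'⟩
    have h1 : (1 : Matrix (Fin N) (Fin N) ℂ) ⊗ₖ Ns k * (1 : Matrix (Fin N) (Fin N) ℂ) ⊗ₖ S (mom k) = 1 := by
      rw [← Matrix.mul_kronecker_mul, Matrix.one_mul, mul_eq_one_comm.1 (hSN k),
        Matrix.one_kronecker_one]
    simp only [Matrix.of_apply, h1, Matrix.one_apply, Prod.mk.injEq]
    by_cases hk : k = k' <;> simp [hk]
  have hPu : Pᴴ * P = 1 := by rw [hP]; exact planeP_conjTranspose_mul_self
  have hPP : P * Pᴴ = 1 := mul_eq_one_comm.1 hPu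
  refine Matrix.inv_eq_right_inv ?_
  rw [← Matrix.mul_assoc, ← Matrix.mul_assoc, hBP, Matrix.mul_assoc P, hNS, Matrix.mul_one, hPP]

/-- **Trace formulas in the plane-wave basis, `N` colours** (abstract form of
`stub_blockHessianFormulaAuxAllN`): with the momentum blocks `Â(k,k') = Σ_{y,z} χ_k(y) χ_{k'}(z) A[(y,·),(z,·)]`,
`tr (B⁰⁻¹ A) = (1/16) Σ_k tr ((1_N ⊗ S(P_k)) Â(k,k))` and
`tr (B⁰⁻¹ A B⁰⁻¹ B) = (1/256) Σ_{k,k'} tr ((1_N ⊗ S(P_k)) Â(k,k') (1_N ⊗ S(P_{k'})) B̂(k',k))`. -/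
theorem trace_formulas
    (hu : ∀ μ, (u μ : Matrix (Fin N) (Fin N) ℂ) = Complex.exp (↑(θ μ) * I) • (1 : Matrix (Fin N) (Fin N) ℂ))
    (hB0 : B0 = wilsonDirac (unitaryFundamentalRep (Fin N) ℂ) (fun e : Edge 4 2 => u e.2) m 1)
    (hMw : ∀ P, Mw P = m + ∑ κ, (1 - Real.cos (P κ)))
    (hh : ∀ P, h P = Mw P ^ 2 + ∑ κ, Real.sin (P κ) ^ 2)
    (hS : ∀ P, S P = ((h P)⁻¹ : ℂ) • (((Mw P : ℝ) : ℂ) • (1 : Matrix (Fin 4) (Fin 4) ℂ) -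
      I • ∑ κ, ((Real.sin (P κ) : ℝ) : ℂ) • euclideanGamma κ))
    (hmom : ∀ s κ, mom s κ = θ κ + Real.pi * ((s κ).val : ℝ))
    (hchi : ∀ s x, chi s x = (-1 : ℝ) ^ (∑ κ, (s κ).val * (x κ).val))
    (hhat : ∀ A k k', hat A k k' =
      ∑ y, ∑ z, ((chi k y * chi k' z : ℝ) : ℂ) • Matrix.of fun c c' : Fin N × Fin 4 => A (y, c) (z, c'))
    (hpos : ∀ s, 0 < h (mom s)) :
    (∀ A, (B0⁻¹ * A).trace =
      (1 / 16 : ℂ) * ∑ k, ((1 : Matrix (Fin N) (Fin N) ℂ) ⊗ₖ S (mom k) * hat A k k).trace) ∧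
    (∀ A B, (B0⁻¹ * A * (B0⁻¹ * B)).trace = (1 / 256 : ℂ) * ∑ k, ∑ k',
      ((1 : Matrix (Fin N) (Fin N) ℂ) ⊗ₖ S (mom k) * hat A k k' *
        ((1 : Matrix (Fin N) (Fin N) ℂ) ⊗ₖ S (mom k') * hat B k' k)).trace) := by
  -- adapted from the sibling's `BlockHessianFormula.trace_formulas` (`Fin 3 ↦ Fin N`)
  have hinv := inv_eq m θ u B0 Mw h S mom hu hB0 hMw hh hS hmom hpos
  set P : Matrix (TorusSite 4 2 × Fin N × Fin 4) (TorusSite 4 2 × Fin N × Fin 4) ℂ :=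
    (Matrix.of fun x k : TorusSite 4 2 => (((2 : ℕ) : ℂ) ^ 2)⁻¹ * torusChar k x) ⊗ₖ
      (1 : Matrix (Fin N × Fin 4) (Fin N × Fin 4) ℂ) with hP
  set Sd : Matrix (TorusSite 4 2 × Fin N × Fin 4) (TorusSite 4 2 × Fin N × Fin 4) ℂ :=
    Matrix.of fun q q' : TorusSite 4 2 × Fin N × Fin 4 =>
      if q.1 = q'.1 then ((1 : Matrix (Fin N) (Fin N) ℂ) ⊗ₖ S (mom q.1)) q.2 q'.2 else 0 with hSd
  have hct : ∀ k y : TorusSite 4 2, torusChar k y = ((chi k y : ℝ) : ℂ) := fun k y => by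
    rw [torusChar_two, hchi]
  -- the momentum blocks of `Pᴴ A P`
  have hblock : ∀ (A : Matrix (TorusSite 4 2 × Fin N × Fin 4) (TorusSite 4 2 × Fin N × Fin 4) ℂ)
      (k k' : TorusSite 4 2),
      (Matrix.of fun c c' : Fin N × Fin 4 => (Pᴴ * A * P) (k, c) (k', c')) = (1 / 16 : ℂ) • hat A k k' := by
    intro A k k'
    ext c c'
    rw [Matrix.of_apply, hP, sandwich_apply, hhat]
    simp only [Matrix.smul_apply, Matrix.sum_apply, Matrix.of_apply, smul_eq_mul, Finset.mul_sum, hct,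
      star_mul', Complex.star_def, Complex.conj_ofReal, map_inv₀, map_pow, map_natCast,
      Complex.ofReal_mul]
    refine Finset.sum_congr rfl fun y _ => Finset.sum_congr rfl fun z _ => ?_
    push_cast
    ring
  refine ⟨fun A => ?_, fun A B => ?_⟩
  · rw [hinv, show P * Sd * Pᴴ * A = P * (Sd * (Pᴴ * A)) by simp only [Matrix.mul_assoc],
      Matrix.trace_mul_comm, show Sd * (Pᴴ * A) * P = Sd * (Pᴴ * A * P) by
        simp only [Matrix.mul_assoc], hSd,
      trace_blockDiag_mul (fun k => (1 : Matrix (Fin N) (Fin N) ℂ) ⊗ₖ S (mom k)) (Pᴴ * A * P),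
      Finset.mul_sum]
    refine Finset.sum_congr rfl fun k _ => ?_
    rw [hblock]
    simp only [Matrix.mul_smul, Matrix.trace_smul, smul_eq_mul]
  · rw [hinv, show P * Sd * Pᴴ * A * (P * Sd * Pᴴ * B) = P * (Sd * (Pᴴ * A * P) * (Sd * (Pᴴ * B))) by
        simp only [Matrix.mul_assoc], Matrix.trace_mul_comm,
      show Sd * (Pᴴ * A * P) * (Sd * (Pᴴ * B)) * P = Sd * (Pᴴ * A * P) * (Sd * (Pᴴ * B * P)) by
        simp only [Matrix.mul_assoc], hSd,
      trace_blockDiag_mul_mul (fun k => (1 : Matrix (Fin N) (Fin N) ℂ) ⊗ₖ S (mom k))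
        (fun k => (1 : Matrix (Fin N) (Fin N) ℂ) ⊗ₖ S (mom k)) (Pᴴ * A * P) (Pᴴ * B * P), Finset.mul_sum]
    refine Finset.sum_congr rfl fun k _ => ?_
    rw [Finset.mul_sum]
    refine Finset.sum_congr rfl fun k' _ => ?_
    rw [hblock, hblock]
    simp only [Matrix.mul_smul, Matrix.smul_mul, Matrix.trace_smul, smul_eq_mul]
    ring

end FreeBlock

end BlockHessianFormula

open BlockHessianFormula in
/-- **Sub-goal `stub_blockHessianFormulaAuxAllN`** (plane-wave trace formulas for the free block propagator,
`N` colours): on the `2⁴` block with constant central phases `u_μ = e^{iθ_μ}·1 ∈ U(N)` and all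
`h(θ + πs) > 0`, for ALL matrices `A, B`: `tr (B⁰⁻¹ A) = (1/16) Σ_k tr ((1_N ⊗ S(P_k)) Â(k,k))` and
`tr (B⁰⁻¹ A B⁰⁻¹ B) = (1/256) Σ_{k,k'} tr ((1_N ⊗ S(P_k)) Â(k,k') (1_N ⊗ S(P_{k'})) B̂(k',k))`,
`Â(k,k') = Σ_{y,z} χ_k(y) χ_{k'}(z) A[(y,·),(z,·)]`, `χ_s(x) = (−1)^{s·x}`, `P_k = θ + πk`,
`S(P) = (M_W(P) − iΣ sin P_κ γ_κ)/h(P)` (`B0, Mw, h, S, mom, chi, hat` given by their defining equations). -/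
theorem stub_blockHessianFormulaAuxAllN : ∀ (N : ℕ) (m : ℝ) (θ : Fin 4 → ℝ) (u : Fin 4 → Matrix.unitaryGroup (Fin N) ℂ), (∀ μ, ((u μ : Matrix.unitaryGroup (Fin N) ℂ) : Matrix (Fin N) (Fin N) ℂ) = Complex.exp (↑(θ μ) * Complex.I) • (1 : Matrix (Fin N) (Fin N) ℂ)) → ∀ (B0 : Matrix (TorusSite 4 2 × Fin N × Fin 4) (TorusSite 4 2 × Fin N × Fin 4) ℂ) (Mw h : (Fin 4 → ℝ) → ℝ) (S : (Fin 4 → ℝ) → Matrix (Fin 4) (Fin 4) ℂ) (mom : (Fin 4 → ZMod 2) → Fin 4 → ℝ) (chi : (Fin 4 → ZMod 2) → TorusSite 4 2 → ℝ) (hat : Matrix (TorusSite 4 2 × Fin N × Fin 4) (TorusSite 4 2 × Fin N × Fin 4) ℂ → (Fin 4 → ZMod 2) → (Fin 4 → ZMod 2) → Matrix (Fin N × Fin 4) (Fin N × Fin 4) ℂ), B0 = wilsonDirac (unitaryFundamentalRep (Fin N) ℂ) (fun e : Edge 4 2 => u e.2) m 1 → (∀ P, Mw P = m + ∑ κ :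 Fin 4, (1 - Real.cos (P κ))) → (∀ P, h P = Mw P ^ 2 + ∑ κ : Fin 4, Real.sin (P κ) ^ 2) → (∀ P, S P = ((h P)⁻¹ : ℂ) • (((Mw P : ℝ) : ℂ) • (1 : Matrix (Fin 4) (Fin 4) ℂ) - Complex.I • ∑ κ : Fin 4, ((Real.sin (P κ) : ℝ) : ℂ) • euclideanGamma κ)) → (∀ s κ, mom s κ = θ κ + Real.pi * ((s κ).val : ℝ)) → (∀ s x, chi s x = (-1 : ℝ) ^ (∑ κ : Fin 4, (s κ).val * (x κ).val)) → (∀ A k k', hat A k k' = ∑ y : TorusSite 4 2, ∑ z : TorusSite 4 2, ((chi k y * chi k' z : ℝ) : ℂ) • Matrix.of (fun c c' : Fin N × Fin 4 => A (y, c) (z, c'))) → (∀ s : Fin 4 → ZMod 2, 0 < h (mom s)) → (∀ A : Matrix (TorusSite 4 2 × Fin N × Fin 4) (TorusSite 4 2 × Fin N × Fin 4) ℂ, (B0⁻¹ * A).trace = (1 / 16 : ℂ) * ∑ k : Fin 4 → ZMod 2, (Matrix.kroneckerMap (fun a b => a * b) (1 : Matrix (Fin N) (Fin N) ℂ) (S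 (mom k)) * hat A k k).trace) ∧ (∀ A B : Matrix (TorusSite 4 2 × Fin N × Fin 4) (TorusSite 4 2 × Fin N × Fin 4) ℂ, (B0⁻¹ * A * (B0⁻¹ * B)).trace = (1 / 256 : ℂ) * ∑ k : Fin 4 → ZMod 2, ∑ k' : Fin 4 → ZMod 2, (Matrix.kroneckerMap (fun a b => a * b) (1 : Matrix (Fin N) (Fin N) ℂ) (S (mom k)) * hat A k k' * (Matrix.kroneckerMap (fun a b => a * b) (1 : Matrix (Fin N) (Fin N) ℂ) (S (mom k')) * hat B k' k)).trace) := by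
  intro N m θ u hu B0 Mw h S mom chi hat hB0 hMw hh hS hmom hchi hhat hpos
  exact trace_formulas m θ u B0 Mw h S mom chi hat hu hB0 hMw hh hS hmom hchi hhat hpos

end Summit.QuantumFields.QCD.Cruxes.FlatCellOptimal.BlockHessian

end
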